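import Mathlib
import HarnessLib
import Literature.MathematicalPhysics.QuantumFieldTheory.OSReconstructionNoE1Proofs
import Summits.QuantumFields.YangMills.Theorems.PencilRigidityCurvatureKernelBoundChartDerivativeBoundsTranslation
import Summits.QuantumFields.YangMills.Theorems.PencilRigidityCurvatureKernelBoundChartDerivativeBoundsSpectral
import Summits.QuantumFields.YangMills.Theorems.PencilRigidityCurvatureKernelBoundChartDerivativeBoundsTensor
import Summits.QuantumFields.YangMills.Theorems.PencilRigidityCurvatureKernelBoundChartDerivativeBoundsFrame

/-!
# `CurvatureKernelBound` — stub A1 support: the core Osterwalder–Schrader derivative estimate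

Support file for crux `stmt-QuantumFields-11687` (`PencilRigidity.CurvatureKernelBound`), line
`sixteen-charts-analytic-kernel`, stub `ChartDerivativeBounds` (A1).  In the time frame `e₀`, for a
one-species family `𝔖` with reflection positivity and translation invariance on `⁰𝒮`
(`h : OSReconstructionNoE1 𝔖.toLabelled`):

* `inner_fieldVec_transfer_eq_tensor_right/left`: `⟪Ψ_φ, e^{-tH}Ψ_χ⟫` is the two-point value of
  `(conj∘φ∘θ) ⊗ χ(· − te₀)` and of `(conj∘φ∘θ)(· + te₀) ⊗ χ`;
* `norm_fieldVec_sq_le`: `‖Ψ_φ‖² ≤ |𝔖₂((conj∘φ∘θ) ⊗ φ)|`;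
* **`CoreDerivativeSumBound`** (registered sub-goal): one Schwartz order `M` and one constant `K`
  such that for all `N`, `0 < δ ≤ 1`, `supp f ⊆ {y₀ < 0}`, `supp g ⊆ {y₀ > δ}`:
  `|𝔖₂(f ⊗ ∂₀ᴺ g)|, |𝔖₂(∂₀ᴺ f ⊗ g)| ≤ (2N/(eδ))ᴺ · K · (|f|_M² + |g|_M²)`
  (OS 1973 §4.1; Glimm–Jaffe Thm. 6.1.3, made quantitative: the chains
  `t ↦ (−1)ʲ𝔖₂(f ⊗ (∂₀ʲg₁)(· − te₀))` and `t ↦ (−1)ʲ𝔖₂((∂₋₀ʲ f)(· + te₀) ⊗ g₁)` both start at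
  `⟪Ψ_{conj f∘θ}, e^{-tH} Ψ_{g₁}⟫`, `g₁ = g(· + δe₀/2)`).
[folklore]
-/

noncomputable section

open scoped SchwartzMap LineDeriv ComplexConjugate InnerProductSpace
open Filter Set MeasureTheory
open Literature.MathematicalPhysics.AQFT Literature.MathematicalPhysics.QuantumLattice
open Literature.MathematicalPhysics.QuantumFieldTheory
open Literature.MathematicalPhysics.QuantumLattice.SchwingerFamily (timeVec)

namespace Summit.QuantumFields.YangMills.Theorems.CurvatureKernel

variable {d : ℕ} [NeZero d]

/-! ## Field vectors of one-point functions and the semigroup -/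

section FieldVec

variable {S : SchwingerFamily (EuclideanSpace ℝ (Fin d))} (h : OSReconstructionNoE1 S.toLabelled)

/-- **`⟪Ψ_φ, e^{-tH} Ψ_χ⟫ = 𝔖₂((conj∘φ∘θ) ⊗ χ(· − t e₀))`** for `t ≥ 0`. [folklore] -/
theorem inner_fieldVec_transfer_eq_tensor_right {φ χ : 𝓢(EuclideanSpace ℝ (Fin d), ℂ)}
    (hφ : IsTimeOrdered (SchwartzMap.tensorFin 1 ![φ])) (hχ : IsTimeOrdered (SchwartzMap.tensorFin 1 ![χ]))
    {t : ℝ} (ht : 0 ≤ t) :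
    ⟪h.fieldVec 1 (fun _ => ()) _ hφ, h.transfer t (h.fieldVec 1 (fun _ => ()) _ hχ)⟫_ℂ =
      S 2 (SchwartzMap.tensorFin 2 ![starTest (thetaTest d φ),
        SchwartzMap.compSubConstCLM ℂ (t • EuclideanSpace.single (0 : Fin d) (1 : ℝ)) χ]) := by
  rw [h.transfer_fieldVec ht, h.inner_fieldVec_fieldVec (fun _ => ()) (fun _ => ()) hφ _
    (isAppendTensorOf_conjTheta_translate_right φ χ (timeVec t)), ← euclideanSingle_zero_eq_smul]
  rfl

/-- **`⟪Ψ_φ, e^{-tH} Ψ_χ⟫ = 𝔖₂((conj∘φ∘θ)(· + t e₀) ⊗ χ)`** for `t ≥ 0` (`e^{-tH}` is symmetric). [folklore] -/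
theorem inner_fieldVec_transfer_eq_tensor_left {φ χ : 𝓢(EuclideanSpace ℝ (Fin d), ℂ)}
    (hφ : IsTimeOrdered (SchwartzMap.tensorFin 1 ![φ])) (hχ : IsTimeOrdered (SchwartzMap.tensorFin 1 ![χ]))
    {t : ℝ} (ht : 0 ≤ t) :
    ⟪h.fieldVec 1 (fun _ => ()) _ hφ, h.transfer t (h.fieldVec 1 (fun _ => ()) _ hχ)⟫_ℂ =
      S 2 (SchwartzMap.tensorFin 2 ![SchwartzMap.compSubConstCLM ℂ
        (-(t • EuclideanSpace.single (0 : Fin d) (1 : ℝ))) (starTest (thetaTest d φ)), χ]) := by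
  rw [← h.inner_transfer_left, h.transfer_fieldVec ht,
    h.inner_fieldVec_fieldVec (fun _ => ()) (fun _ => ()) _ hχ
      (isAppendTensorOf_conjTheta_translate_left φ χ (timeVec t)),
    SchwingerFamily.timeReflection_timeVec, ← euclideanSingle_zero_eq_smul]
  rfl

/-- **`‖Ψ_φ‖² ≤ |𝔖₂((conj∘φ∘θ) ⊗ φ)|`.** [folklore] -/
theorem norm_fieldVec_sq_le {φ : 𝓢(EuclideanSpace ℝ (Fin d), ℂ)}
    (hφ : IsTimeOrdered (SchwartzMap.tensorFin 1 ![φ])) :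
    ‖h.fieldVec 1 (fun _ => ()) _ hφ‖ ^ 2 ≤
      ‖S 2 (SchwartzMap.tensorFin 2 ![starTest (thetaTest d φ), φ])‖ := by
  have h1 : ⟪h.fieldVec 1 (fun _ => ()) _ hφ, h.fieldVec 1 (fun _ => ()) _ hφ⟫_ℂ =
      S 2 (SchwartzMap.tensorFin 2 ![starTest (thetaTest d φ), φ]) := by
    rw [h.inner_fieldVec_fieldVec (fun _ => ()) (fun _ => ()) hφ hφ (isAppendTensorOf_conjTheta φ φ)]
    rfl
  rw [← h1, inner_self_eq_norm_sq_to_K]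
  norm_cast
  simp

end FieldVec

/-! ## The core estimate in the time frame -/

section Core

variable (S : SchwingerFamily (EuclideanSpace ℝ (Fin d)))

/-- **The core Osterwalder–Schrader derivative estimate (sum form).** There are one Schwartz order
`M` and one constant `K ≥ 0` such that for every `N`, every `0 < δ ≤ 1`, and all test functions
`f` supported in `{y₀ < 0}` and `g` supported in `{y₀ > δ}`, both `|𝔖₂(f ⊗ ∂₀ᴺ g)|` and
`|𝔖₂(∂₀ᴺ f ⊗ g)|` are at most `(N/(e δ/2))ᴺ · K · (|f|_M² + |g|_M²)`. [folklore] -/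
theorem norm_two_point_iterate_lineDeriv_le_sum (h : OSReconstructionNoE1 S.toLabelled) :
    ∃ (M : ℕ) (K : ℝ), 0 ≤ K ∧ ∀ (N : ℕ) (δ : ℝ), 0 < δ → δ ≤ 1 →
      ∀ (f g : 𝓢(EuclideanSpace ℝ (Fin d), ℂ)),
        tsupport (f : EuclideanSpace ℝ (Fin d) → ℂ) ⊆ {y | y 0 < 0} →
        tsupport (g : EuclideanSpace ℝ (Fin d) → ℂ) ⊆ {y | δ < y 0} →
        ‖S 2 (SchwartzMap.tensorFin 2 ![f,
            ((∂_{EuclideanSpace.single (0 : Fin d) (1 : ℝ)} :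
              𝓢(EuclideanSpace ℝ (Fin d), ℂ) → 𝓢(EuclideanSpace ℝ (Fin d), ℂ))^[N] g)])‖ ≤
            (N / (Real.exp 1 * (δ / 2))) ^ N * (K * (schwartzNorm M f ^ 2 + schwartzNorm M g ^ 2)) ∧
        ‖S 2 (SchwartzMap.tensorFin 2 ![((∂_{EuclideanSpace.single (0 : Fin d) (1 : ℝ)} :
              𝓢(EuclideanSpace ℝ (Fin d), ℂ) → 𝓢(EuclideanSpace ℝ (Fin d), ℂ))^[N] f), g])‖ ≤
            (N / (Real.exp 1 * (δ / 2))) ^ N * (K * (schwartzNorm M f ^ 2 + schwartzNorm M g ^ 2)) := by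
  obtain ⟨M, C, hS⟩ := SchwingerFamily.exists_bound_holds S 2
  have hS' : ∀ F, ‖S 2 F‖ ≤ |C| * schwartzNorm M F := fun F =>
    (hS F).trans (mul_le_mul_of_nonneg_right (le_abs_self C) (schwartzNorm_nonneg _ _))
  refine ⟨M, |C| * (2 ^ (M + 1)) ^ 2 * 16 ^ M, by positivity, fun N δ hδ hδ1 f g hf hg => ?_⟩
  set e₀ : EuclideanSpace ℝ (Fin d) := EuclideanSpace.single (0 : Fin d) (1 : ℝ) with he₀
  have he₀n : ‖e₀‖ = 1 := by simp [he₀]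
  -- the positive-time one-point functions `φ = conj ∘ f ∘ θ` and `g₁ = g(· + δe₀/2)`
  set φ : 𝓢(EuclideanSpace ℝ (Fin d), ℂ) := starTest (thetaTest d f) with hφdef
  set g₁ : 𝓢(EuclideanSpace ℝ (Fin d), ℂ) := SchwartzMap.compSubConstCLM ℂ (-((δ / 2) • e₀)) g with hg₁def
  have hφ : tsupport (φ : EuclideanSpace ℝ (Fin d) → ℂ) ⊆ {y | 0 < y 0} :=
    tsupport_starTest_thetaTest_subset_pos hf
  have hg₁ : tsupport (g₁ : EuclideanSpace ℝ (Fin d) → ℂ) ⊆ {y | 0 < y 0} := by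
    intro y hy
    have h1 := hg (sub_mem_tsupport_of_mem_tsupport_compSubConstCLM _ g hy)
    simp only [mem_setOf_eq, he₀, sub_neg_eq_add] at h1
    have h2 : (y + (δ / 2) • EuclideanSpace.single (0 : Fin d) (1 : ℝ)) 0 = y 0 + δ / 2 := by simp
    rw [h2] at h1
    show 0 < y 0
    linarith
  have hφT := isTimeOrdered_tensorFin_one hφ
  have hg₁T := isTimeOrdered_tensorFin_one hg₁
  set ψ₁ : h.Hilbert := h.fieldVec 1 (fun _ => ()) _ hφT with hψ₁
  set ψ₂ : h.Hilbert := h.fieldVec 1 (fun _ => ()) _ hg₁T with hψ₂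
  set X : 𝓢((Fin 2 → EuclideanSpace ℝ (Fin d)), ℂ) := SchwartzMap.tensorFin 2 ![f, g₁] with hX
  set w : Fin 2 → EuclideanSpace ℝ (Fin d) := Pi.single 1 e₀ with hw
  set w' : Fin 2 → EuclideanSpace ℝ (Fin d) := Pi.single 0 (-e₀) with hw'
  -- the two chains of derivatives
  set G : ℕ → ℝ → ℂ := fun j t => (-1 : ℂ) ^ j * S 2 (SchwartzMap.compSubConstCLM ℂ (t • w)
    ((∂_{w} : 𝓢((Fin 2 → EuclideanSpace ℝ (Fin d)), ℂ) → 𝓢((Fin 2 → EuclideanSpace ℝ (Fin d)), ℂ))^[j] X))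
    with hG
  set G' : ℕ → ℝ → ℂ := fun j t => (-1 : ℂ) ^ j * S 2 (SchwartzMap.compSubConstCLM ℂ (t • w')
    ((∂_{w'} : 𝓢((Fin 2 → EuclideanSpace ℝ (Fin d)), ℂ) → 𝓢((Fin 2 → EuclideanSpace ℝ (Fin d)), ℂ))^[j] X))
    with hG'
  have hGd : ∀ (j : ℕ) (t : ℝ), 0 < t → HasDerivAt (G j) (G (j + 1) t) t := fun j t _ =>
    hasDerivAt_iterate_lineDerivOp_translate (S 2) X w j t
  have hG'd : ∀ (j : ℕ) (t : ℝ), 0 < t → HasDerivAt (G' j) (G' (j + 1) t) t := fun j t _ =>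
    hasDerivAt_iterate_lineDerivOp_translate (S 2) X w' j t
  -- both chains start at `⟪ψ₁, e^{-tH} ψ₂⟫`
  have hG0 : ∀ t : ℝ, 0 < t → G 0 t = ⟪ψ₁, h.transfer t ψ₂⟫_ℂ := by
    intro t ht
    rw [hψ₁, hψ₂, inner_fieldVec_transfer_eq_tensor_right h hφT hg₁T ht.le, hφdef,
      starTest_thetaTest_starTest_thetaTest]
    simp only [hG, pow_zero, one_mul, Function.iterate_zero, id_eq, hw, smul_pi_single_fin_two, hX,
      compSubConstCLM_single_one_tensorFin_two, he₀]
  have hG'0 : ∀ t : ℝ, 0 < t → G' 0 t = ⟪ψ₁, h.transfer t ψ₂⟫_ℂ := by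
    intro t ht
    rw [hψ₁, hψ₂, inner_fieldVec_transfer_eq_tensor_left h hφT hg₁T ht.le, hφdef]
    simp only [hG', pow_zero, one_mul, Function.iterate_zero, id_eq, hw', smul_pi_single_fin_two, hX,
      compSubConstCLM_single_zero_tensorFin_two, smul_neg, he₀, starTest_thetaTest_starTest_thetaTest]
  -- the spectral bounds
  have hB := norm_iterDeriv_inner_transfer_le h ψ₁ ψ₂ G hG0 hGd N (half_pos hδ)
  have hB' := norm_iterDeriv_inner_transfer_le h ψ₁ ψ₂ G' hG'0 hG'd N (half_pos hδ)
  -- identification of the `N`-th terms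
  have hg₁back : SchwartzMap.compSubConstCLM ℂ ((δ / 2) • e₀) g₁ = g := by
    rw [hg₁def, SchwartzMap.compSubConstCLM_comp, neg_add_cancel, SchwartzMap.compSubConstCLM_zero]
    rfl
  have hGN : G N (δ / 2) = (-1 : ℂ) ^ N * S 2 (SchwartzMap.tensorFin 2 ![f,
      ((∂_{e₀} : 𝓢(EuclideanSpace ℝ (Fin d), ℂ) → 𝓢(EuclideanSpace ℝ (Fin d), ℂ))^[N] g)]) := by
    simp only [hG, hw, smul_pi_single_fin_two, hX, iterate_lineDerivOp_single_one_tensorFin_two,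
      compSubConstCLM_single_one_tensorFin_two, ← iterate_lineDerivOp_compSubConstCLM, hg₁back]
  have hOff : IsOffDiagonal (SchwartzMap.tensorFin 2
      ![((∂_{e₀} : 𝓢(EuclideanSpace ℝ (Fin d), ℂ) → 𝓢(EuclideanSpace ℝ (Fin d), ℂ))^[N] f), g]) := by
    refine isOffDiagonal_tensorFin_two_of_disjoint (Set.disjoint_left.2 fun y hyf hyg => ?_)
    have h1 : y 0 < 0 := hf (tsupport_iterate_lineDerivOp_subset e₀ N f hyf)
    have h2 : δ < y 0 := hg hyg
    linarith
  have hG'N : G' N (δ / 2) = S 2 (SchwartzMap.tensorFin 2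
      ![((∂_{e₀} : 𝓢(EuclideanSpace ℝ (Fin d), ℂ) → 𝓢(EuclideanSpace ℝ (Fin d), ℂ))^[N] f), g]) := by
    have h1 : ((∂_{w'} : 𝓢((Fin 2 → EuclideanSpace ℝ (Fin d)), ℂ) → 𝓢((Fin 2 → EuclideanSpace ℝ (Fin d)), ℂ))^[N] X) =
        (-1 : ℂ) ^ N • SchwartzMap.tensorFin 2
          ![((∂_{e₀} : 𝓢(EuclideanSpace ℝ (Fin d), ℂ) → 𝓢(EuclideanSpace ℝ (Fin d), ℂ))^[N] f), g₁] := by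
      rw [hw', Pi.single_neg, iterate_lineDerivOp_neg, hX, iterate_lineDerivOp_single_zero_tensorFin_two]
    have h2 : SchwartzMap.compSubConstCLM ℂ ((δ / 2) • w') (SchwartzMap.tensorFin 2
        ![((∂_{e₀} : 𝓢(EuclideanSpace ℝ (Fin d), ℂ) → 𝓢(EuclideanSpace ℝ (Fin d), ℂ))^[N] f), g₁]) =
        translateMulti (-((δ / 2) • e₀)) (SchwartzMap.tensorFin 2
          ![((∂_{e₀} : 𝓢(EuclideanSpace ℝ (Fin d), ℂ) → 𝓢(EuclideanSpace ℝ (Fin d), ℂ))^[N] f), g]) := by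
      rw [hw', smul_pi_single_fin_two, smul_neg, compSubConstCLM_single_zero_tensorFin_two,
        translateMulti_tensorFin_two, hg₁def]
    have h3 := h.translationInvariant 2 (fun _ => ()) (-((δ / 2) • e₀)) _ hOff
    simp only [SchwingerFamily.toLabelled_apply] at h3
    simp only [hG']
    rw [h1, map_smul, map_smul, h2, h3, smul_eq_mul, ← mul_assoc, ← mul_pow]
    norm_num
  -- norms of the field vectors
  have hψ₁n : ‖ψ₁‖ ^ 2 ≤ |C| * (2 ^ (M + 1)) ^ 2 * schwartzNorm M f ^ 2 := by
    refine (norm_fieldVec_sq_le h hφT).trans ?_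
    rw [hφdef, starTest_thetaTest_starTest_thetaTest]
    refine (hS' _).trans ?_
    have h1 := schwartzNorm_tensorFin_two_le M f (starTest (thetaTest d f))
    have h2 := schwartzNorm_starTest_thetaTest_le M f
    have h3 := schwartzNorm_nonneg M f
    have h4 := schwartzNorm_nonneg M (starTest (thetaTest d f))
    calc |C| * schwartzNorm M (SchwartzMap.tensorFin 2 ![f, starTest (thetaTest d f)])
        ≤ |C| * ((2 ^ (M + 1)) ^ 2 * schwartzNorm M f * schwartzNorm M (starTest (thetaTest d f))) := by
          gcongr
      _ ≤ |C| * ((2 ^ (M + 1)) ^ 2 * schwartzNorm M f * schwartzNorm M f) := by gcongr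
      _ = |C| * (2 ^ (M + 1)) ^ 2 * schwartzNorm M f ^ 2 := by ring
  have hψ₂n : ‖ψ₂‖ ^ 2 ≤ |C| * (2 ^ (M + 1)) ^ 2 * 16 ^ M * schwartzNorm M g ^ 2 := by
    refine (norm_fieldVec_sq_le h hg₁T).trans ((hS' _).trans ?_)
    have h1 := schwartzNorm_tensorFin_two_le M (starTest (thetaTest d g₁)) g₁
    have h2 := schwartzNorm_starTest_thetaTest_le M g₁
    have ha : ‖-((δ / 2) • e₀)‖ ≤ 1 := by
      rw [norm_neg, norm_smul, he₀n, mul_one, Real.norm_of_nonneg (by positivity)]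
      linarith
    have h3 : schwartzNorm M g₁ ≤ 4 ^ M * schwartzNorm M g :=
      schwartzNorm_compSubConstCLM_le_of_norm_le_one M ha g
    have h4 := schwartzNorm_nonneg M g
    have h5 := schwartzNorm_nonneg M (starTest (thetaTest d g₁))
    have h6 := schwartzNorm_nonneg M g₁
    calc |C| * schwartzNorm M (SchwartzMap.tensorFin 2 ![starTest (thetaTest d g₁), g₁])
        ≤ |C| * ((2 ^ (M + 1)) ^ 2 * schwartzNorm M (starTest (thetaTest d g₁)) * schwartzNorm M g₁) := by
          gcongr
      _ ≤ |C| * ((2 ^ (M + 1)) ^ 2 * (4 ^ M * schwartzNorm M g) * (4 ^ M * schwartzNorm M g)) := by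
          gcongr
          exact h2.trans h3
      _ = |C| * (2 ^ (M + 1)) ^ 2 * 16 ^ M * schwartzNorm M g ^ 2 := by
          rw [show (16 : ℝ) ^ M = 4 ^ M * 4 ^ M by rw [← mul_pow]; norm_num]
          ring
  have hsum : ‖ψ₁‖ ^ 2 + ‖ψ₂‖ ^ 2 ≤
      |C| * (2 ^ (M + 1)) ^ 2 * 16 ^ M * (schwartzNorm M f ^ 2 + schwartzNorm M g ^ 2) := by
    have h16 : (1 : ℝ) ≤ 16 ^ M := one_le_pow₀ (by norm_num)
    have h3 := schwartzNorm_nonneg M f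
    nlinarith [hψ₁n, hψ₂n, sq_nonneg (schwartzNorm M f), abs_nonneg C]
  have hpos : 0 ≤ (N / (Real.exp 1 * (δ / 2))) ^ N := by positivity
  constructor
  · have h1 : ‖S 2 (SchwartzMap.tensorFin 2 ![f,
        ((∂_{e₀} : 𝓢(EuclideanSpace ℝ (Fin d), ℂ) → 𝓢(EuclideanSpace ℝ (Fin d), ℂ))^[N] g)])‖ = ‖G N (δ / 2)‖ := by
      rw [hGN, norm_mul, norm_pow, norm_neg, norm_one, one_pow, one_mul]
    rw [h1]
    exact hB.trans (mul_le_mul_of_nonneg_left hsum hpos)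
  · rw [← hG'N]
    exact hB'.trans (mul_le_mul_of_nonneg_left hsum hpos)

end Core

/-- **Sub-goal `CoreDerivativeSumBound`** (helper for stub `ChartDerivativeBounds`): the core
Osterwalder–Schrader derivative estimate in the time frame, sum form — one Schwartz order `M` and
one constant `K` control `|𝔖₂(f ⊗ ∂₀ᴺ g)|` and `|𝔖₂(∂₀ᴺ f ⊗ g)|` by
`(N/(e δ/2))ᴺ K (|f|_M² + |g|_M²)` across the gap `δ` (OS 1973 §4.1; Glimm–Jaffe Thm. 6.1.3). [folklore] -/
theorem CoreDerivativeSumBound : open Literature.MathematicalPhysics.QuantumLattice Literature.MathematicalPhysics.AQFT Literature.MathematicalPhysics.QuantumFieldTheory in ∀ {d : ℕ} [NeZero d] (S : SchwingerFamily (EuclideanSpace ℝ (Fin d))), OSReconstructionNoE1 S.toLabelled → ∃ (M : ℕ) (K : ℝ), 0 ≤ K ∧ ∀ (N : ℕ) (δ : ℝ), 0 < δ → δ ≤ 1 → ∀ (f g : SchwartzMap (EuclideanSpace ℝ (Fin d)) ℂ), tsupport (f : EuclideanSpace ℝ (Fin d) → ℂ) ⊆ {y : EuclideanSpace ℝ (Fin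 d) | y 0 < 0} → tsupport (g : EuclideanSpace ℝ (Fin d) → ℂ) ⊆ {y : EuclideanSpace ℝ (Fin d) | δ < y 0} → ‖S 2 (SchwartzMap.tensorFin 2 ![f, ((LineDeriv.lineDerivOp (EuclideanSpace.single (0 : Fin d) (1 : ℝ)) : SchwartzMap (EuclideanSpace ℝ (Fin d)) ℂ → SchwartzMap (EuclideanSpace ℝ (Fin d)) ℂ)^[N] g)])‖ ≤ (N / (Real.exp 1 * (δ / 2))) ^ N * (K * (schwartzNorm M f ^ 2 + schwartzNorm M g ^ 2)) ∧ ‖S 2 (SchwartzMap.tensorFin 2 ![((LineDeriv.lineDerivOp (EuclideanSpace.single (0 : Fin d) (1 : ℝ)) : SchwartzMap (EuclideanSpace ℝ (Fin d)) ℂ → SchwartzMap (EuclideanSpace ℝ (Fin d)) ℂ)^[N] f), g])‖ ≤ (N / (Real.exp 1 * (δ / 2))) ^ N * (K * (schwartzNorm M f ^ 2 + schwartzNorm M g ^ 2)) := by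
  intro d _ S h
  exact norm_two_point_iterate_lineDeriv_le_sum S h

end Summit.QuantumFields.YangMills.Theorems.CurvatureKernel
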